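import Summits.CriticalPhenomena.PercolationContinuityZ3.Theorems.Transplant.SkelNegParamsCoarse
import HarnessLib

/-!
# N1 params, part 0c (q-free arithmetic, consumer-independent): THE SECOND LATTICE VECTOR AND THE COARSE MAP OF RECORD — the top-layer point
# `v = (v_α, v_β)` read off the long equilibrium split `v_L` (`v_β := ⌊(n_L ℓ_L + h_L v_α)/n_L⌋`, so that `n_L v_β − h_L v_α ∈ (n_L ℓ_L − n_L, n_L ℓ_L]`
# lies in the top layer), the determinant `D = detD 800 n h v_α v_β`, and **`Skelφ.NegPrm.coarse φ t K n h ℓ v_α := coarseSkel φ t 800 n h v_α v_β (20K) (D/2) (D/2) D`**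
# (`A′ = 800`, `c = 20K`, nearest-cell rounding) with its three facts from the ledger floors: 1-Lipschitz, kit-drift reading `c_R′ = 1`, every cell is hit

builds on p205010 (kernel theorem, internal audit signed; external expert review pending) — nothing in this file uses p205010.
Status sentence (coordinator 2026-08-20T04:30Z): "θ(p_c) = 0 on ℤ^d, all d ≥ 2 — kernel-verified (Lean 4/Mathlib, standard axioms); internal adversarial
audit SIGNED 2026-08-20 04:29Z; external expert review pending."
Lane `prim-bschramm-*`, seat `prim-bschramm-stmt` (gen 12); helper file (`--supports stmt-CriticalPhenomena-4575 --as helper`); ledger HOME/prim-bschramm-stmt/NEG-PARAMS.md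
v0.5 (n1) (cells over `ρ ∘ φ`), (n8) (`u = (n_L, h_L)`, `v = (v_α, v_β)`, `U = A′u`, `V = A′v`, `D = det`, hp-8 C1), (n5)(iii)(iv).  INPUTS: hp-8 g31's `TwoAxis.Para.modulus/detD/coarse/rep/coarse_rep`
(TwoAxisParaCells p266166), `Skelφ.coarseSkel/lip_coarseSkel/coarse_containment` (TwoAxisParaCellsSkel p266580), `Skelφ.exists_mem_graphBall_φ_eq` (COARSE STEPS), and stmt-g11's
discharges `NegPrm.hL0_of_floors/hL1_of_floors/lip_coarseSkel_of_floors/coarse_containment_of_floors` (SkelNegParamsCoarse p267342) whose top-layer hypothesis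
`nℓ − (n+|h|) < modulus ≤ nℓ` THIS file discharges by the choice of `v_β`.
* §1 `vβOf n h ℓ vα := (n·ℓ + h·vα)/n` + `modulus_vβOf` (`nℓ − n < modulus ≤ nℓ`), `modulus_vβOf_layer` (the `hlay` shape), `modulus_vβOf_pos`, `detD_vβOf_pos`;
* §2 `Dof n h ℓ vα := detD 800 n h vα (vβOf …)`, **`coarse φ t K n h ℓ vα`** (THE window map of N1's cells), `coarse_apply`;
* §3 **`lip_coarse`** (`4K + 2 ≤ M`, long-scale `EquilibriumAt` facts ⊢ `Lip G (coarse …)`), **`coarse_drift_le_one`** (`4K·s + 2 ≤ M`, `|Δφ|_∞ ≤ s` ⊢ `|Δρ|_∞ ≤ 1`),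
  **`exists_coarse_eq`** (`8K + 2 ≤ M`, unit steps ⊢ every coarse cell `z` is the coarse position of some vertex, at ℓ¹-graph-distance `‖φ t + rep z − φ w₀‖₁` from any `w₀`).
[cite: MartineauTassion2017, §4.1–4.3 (the cell lattice generated by u and v; det = nℓ up to the layer)] [cite: KozmaNitzan2024, §4 Lemma 10 Step IV (siting by planar position)]
-/

namespace Summit.CriticalPhenomena.PercolationContinuityZ3.Theorems.Transplant

namespace Skelφ

namespace NegPrm

open Literature.Probability.Percolation Literature.Probability.LatticeModels SimpleGraph TwoAxis.Para
open Literature.Barriers.CriticalPhenomena (graphBall)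

/-! ## §1 The second lattice vector -/

/-- **The height of the second lattice vector**: `v_β := ⌊(n·ℓ + h·v_α)/n⌋` — the top-layer point of the parallelogram `{|α| ≤ n, |nβ − hα| ≤ nℓ}` above the
split abscissa `v_α` (hp-8 C1: the second cell vector is the top-layer point `v` itself). [this work] -/
def vβOf (n : ℕ) (h : ℤ) (ℓ : ℕ) (vα : ℤ) : ℤ := ((n : ℤ) * ℓ + h * vα) / n

/-- **`v` lies in the top layer**: `n·ℓ − n < n·v_β − h·v_α ≤ n·ℓ` (`1 ≤ n`). [folklore] -/
theorem modulus_vβOf {n : ℕ} (hn : 1 ≤ n) (h : ℤ) (ℓ : ℕ) (vα : ℤ) :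
    (n : ℤ) * ℓ - n < modulus n h vα (vβOf n h ℓ vα) ∧ modulus n h vα (vβOf n h ℓ vα) ≤ (n : ℤ) * ℓ := by
  have hn0 : (0 : ℤ) < n := by exact_mod_cast hn
  unfold modulus vβOf
  set a : ℤ := (n : ℤ) * ℓ + h * vα with ha
  have h1 : (n : ℤ) * (a / n) ≤ a := Int.mul_ediv_self_le (by positivity)
  have h2 : a < (n : ℤ) * (a / n) + n := by
    have := Int.lt_mul_ediv_self_add (x := a) hn0
    linarith
  constructor <;> linarith

/-- The top-layer constraint in the shape `SkelNegParamsCoarse` / `TwoAxis.Para.modulus_bounds` consume: `n·ℓ − (n + |h|) < modulus ≤ n·ℓ`. [folklore] -/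
theorem modulus_vβOf_layer {n : ℕ} (hn : 1 ≤ n) (h : ℤ) (ℓ : ℕ) (vα : ℤ) :
    (n : ℤ) * ℓ - (n + |h|) < modulus n h vα (vβOf n h ℓ vα) ∧ modulus n h vα (vβOf n h ℓ vα) ≤ (n : ℤ) * ℓ := by
  obtain ⟨h1, h2⟩ := modulus_vβOf hn h ℓ vα
  exact ⟨by linarith [abs_nonneg h], h2⟩

/-- `0 < modulus` as soon as `1 ≤ n` and `1 ≤ ℓ`. [folklore] -/
theorem modulus_vβOf_pos {n ℓ : ℕ} (hn : 1 ≤ n) (hℓ : 1 ≤ ℓ) (h vα : ℤ) : 0 < modulus n h vα (vβOf n h ℓ vα) := by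
  obtain ⟨h1, -⟩ := modulus_vβOf hn h ℓ vα
  have : (n : ℤ) * 1 ≤ (n : ℤ) * ℓ := by gcongr; exact_mod_cast hℓ
  linarith

/-- `0 < detD 800 n h v_α v_β` (`= 800²·modulus`). [folklore] -/
theorem detD_vβOf_pos {n ℓ : ℕ} (hn : 1 ≤ n) (hℓ : 1 ≤ ℓ) (h vα : ℤ) : 0 < detD 800 n h vα (vβOf n h ℓ vα) := by
  have := modulus_vβOf_pos hn hℓ h vα
  unfold detD; positivity

/-! ## §2 The coarse map of record -/

/-- **The determinant of the long cell lattice** `D := detD 800 n h v_α v_β = 800²·(n·v_β − h·v_α)`. [this work] -/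
def Dof (n : ℕ) (h : ℤ) (ℓ : ℕ) (vα : ℤ) : ℤ := detD 800 n h vα (vβOf n h ℓ vα)

/-- `0 < D`. [folklore] -/
theorem Dof_pos {n ℓ : ℕ} (hn : 1 ≤ n) (hℓ : 1 ≤ ℓ) (h vα : ℤ) : 0 < Dof n h ℓ vα := detD_vβOf_pos hn hℓ h vα

variable {V : Type} {G : SimpleGraph V}

/-- **THE COARSE DUAL SKELETON OF N1** (the window map of the cells `⟨K, 1⟩`, NEG-PARAMS (n1)/(n8)): `ρ ∘ φ` for the cell lattice `[800·u 800·v]`,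
`u = (n, h)`, `v = (v_α, v_β)`, resolution `c = 20K` coarse units per cell, nearest-cell rounding (offsets `D/2`): `coarse φ t K n h ℓ v_α :=
coarseSkel φ t 800 n h v_α (vβOf n h ℓ v_α) (20K) (D/2) (D/2) D`, `D = Dof n h ℓ v_α`. [this work] -/
def coarse (φ : V → Site 2) (t : V) (K n : ℕ) (h : ℤ) (ℓ : ℕ) (vα : ℤ) : V → Site 2 :=
  coarseSkel φ t 800 n h vα (vβOf n h ℓ vα) (20 * K) (Dof n h ℓ vα / 2) (Dof n h ℓ vα / 2) (Dof n h ℓ vα)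

/-- `coarse` unfolded. [folklore] -/
theorem coarse_eq (φ : V → Site 2) (t : V) (K n : ℕ) (h : ℤ) (ℓ : ℕ) (vα : ℤ) :
    coarse φ t K n h ℓ vα = coarseSkel φ t 800 n h vα (vβOf n h ℓ vα) (20 * K) (Dof n h ℓ vα / 2) (Dof n h ℓ vα / 2) (Dof n h ℓ vα) := rfl

/-! ## §3 The three facts from the ledger floors -/

/-- `1 ≤ n` and `1 ≤ ℓ` from `0 ≤ X`, `X + 2 ≤ M`, `M + 1 ≤ n`, `M + 1 ≤ ℓ` (bookkeeping). [folklore] -/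
theorem one_le_of_floor {X M : ℤ} {n ℓ : ℕ} (hX : 0 ≤ X) (hM : X + 2 ≤ M) (hn : M + 1 ≤ n) (hℓ : M + 1 ≤ ℓ) : 1 ≤ n ∧ 1 ≤ ℓ := by
  constructor
  · have : (1 : ℤ) ≤ n := by linarith
    exact_mod_cast this
  · have : (1 : ℤ) ≤ ℓ := by linarith
    exact_mod_cast this

/-- **THE COARSE MAP IS 1-LIPSCHITZ** from the floors: `4K + 2 ≤ M` and the long-scale `EquilibriumAt` facts `M + 1 ≤ n`, `M + 1 ≤ ℓ`, `(M+1)(n+|h|) ≤ n(ℓ+1)`,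
`|v_α| ≤ n` (so `PlanarCells2*`, the window spans, the separation lemmas apply to N1's cells verbatim — NEG-PARAMS 1H `rhoLip_at`). [this work] -/
theorem lip_coarse {φ : V → Site 2} (hlip : Lip G φ) (t : V) {K : ℕ} {M : ℤ} {n ℓ : ℕ} {h vα : ℤ} (hM : 4 * (K : ℤ) + 2 ≤ M) (hn : M + 1 ≤ n)
    (hℓ : M + 1 ≤ ℓ) (hlay₁ : (M + 1) * ((n : ℤ) + |h|) ≤ (n : ℤ) * ((ℓ : ℤ) + 1)) (hv : |vα| ≤ (n : ℤ)) : Lip G (coarse φ t K n h ℓ vα) := by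
  have hK : (0 : ℤ) ≤ K := by positivity
  have h1 : 1 ≤ n := (one_le_of_floor (by positivity : (0 : ℤ) ≤ 4 * K) hM hn hℓ).1
  rw [coarse_eq]
  exact lip_coarseSkel_of_floors hlip t hK hM hn hℓ hlay₁ hv (modulus_vβOf_layer h1 h ℓ vα)

/-- **KIT DRIFT READS AS ONE COARSE UNIT** (`c_R′ = 1`): two vertices at planar distance `≤ s` in each coordinate have coarse positions at distance `≤ 1` in each
coordinate, from `4K·s + 2 ≤ M` and the long-scale facts (e.g. `s = R′`: NEG-PARAMS (n5)(iii), (n9)). [this work] -/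
theorem coarse_drift_le_one {φ : V → Site 2} (t : V) {K : ℕ} {M s : ℤ} {n ℓ : ℕ} {h vα : ℤ} (hs : 0 ≤ s) (hM : 4 * (K : ℤ) * s + 2 ≤ M) (hn : M + 1 ≤ n)
    (hℓ : M + 1 ≤ ℓ) (hlay₁ : (M + 1) * ((n : ℤ) + |h|) ≤ (n : ℤ) * ((ℓ : ℤ) + 1)) (hv : |vα| ≤ (n : ℤ)) {w w' : V} (h0 : |φ w 0 - φ w' 0| ≤ s)
    (h1 : |φ w 1 - φ w' 1| ≤ s) (i : Fin 2) : |coarse φ t K n h ℓ vα w i - coarse φ t K n h ℓ vα w' i| ≤ 1 := by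
  have hK : (0 : ℤ) ≤ K := by positivity
  have hn1 : 1 ≤ n := (one_le_of_floor (by positivity : (0 : ℤ) ≤ 4 * K * s) hM hn hℓ).1
  rw [coarse_eq]
  exact coarse_containment_of_floors t hK hs hM hn hℓ hlay₁ hv (modulus_vβOf_layer hn1 h ℓ vα) h0 h1 i

/-- The two representative-admissibility inequalities `20K·L_i + 2 ≤ D` from `8K + 2 ≤ M` (take `s = 2` in the drift floors: `20K·L_i·2 ≤ D` and `20K·L_i ≥ 2`).
[folklore] -/
theorem rep_adm {K : ℕ} {M : ℤ} {n ℓ : ℕ} {h vα : ℤ} (hK : 1 ≤ K) (hM : 8 * (K : ℤ) + 2 ≤ M) (hn : M + 1 ≤ n) (hℓ : M + 1 ≤ ℓ)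
    (hlay₁ : (M + 1) * ((n : ℤ) + |h|) ≤ (n : ℤ) * ((ℓ : ℤ) + 1)) (hv : |vα| ≤ (n : ℤ)) :
    20 * (K : ℤ) * (|(800 : ℤ)| * (|vβOf n h ℓ vα| + |vα|)) + 2 ≤ Dof n h ℓ vα ∧
      20 * (K : ℤ) * (|(800 : ℤ)| * (|(n : ℤ)| + |h|)) + 2 ≤ Dof n h ℓ vα := by
  have hK0 : (0 : ℤ) ≤ K := by positivity
  have hK1 : (1 : ℤ) ≤ K := by exact_mod_cast hK
  have hn1 : 1 ≤ n := (one_le_of_floor (by positivity : (0 : ℤ) ≤ 8 * K) hM hn hℓ).1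
  have hlay := modulus_vβOf_layer hn1 h ℓ vα
  have hM2 : 4 * (K : ℤ) * 2 + 2 ≤ M := by linarith
  have hM1 : (K : ℤ) * 2 + 2 ≤ M := by linarith
  have hL1 := hL1_of_floors (s := 2) hK0 (by norm_num) hM1 hn hℓ hlay₁ hlay
  have hL0 := hL0_of_floors (s := 2) hK0 (by norm_num) hM2 hn hℓ hlay₁ hv hlay
  rw [one_mul] at hL1 hL0
  have hn' : (1 : ℤ) ≤ |(n : ℤ)| := by rw [abs_of_nonneg (by positivity)]; exact_mod_cast hn1
  have e8 : |(800 : ℤ)| = 800 := abs_of_nonneg (by norm_num)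
  rw [e8] at hL1 hL0 ⊢
  refine ⟨?_, ?_⟩
  · -- `L₀ ≥ 800`: `|vβ| + |vα| ≥ 1` since `modulus > 0` forces `(vα, vβ) ≠ 0`
    have hpos : 0 < modulus n h vα (vβOf n h ℓ vα) := by
      have := (one_le_of_floor (by positivity : (0 : ℤ) ≤ 8 * K) hM hn hℓ).2
      exact modulus_vβOf_pos hn1 this h vα
    have hvv : 1 ≤ |vβOf n h ℓ vα| + |vα| := by
      by_contra hc
      push Not at hc
      have ha : |vβOf n h ℓ vα| = 0 := by linarith [abs_nonneg (vβOf n h ℓ vα), abs_nonneg vα]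
      have hb : |vα| = 0 := by linarith [abs_nonneg (vβOf n h ℓ vα), abs_nonneg vα]
      rw [abs_eq_zero] at ha hb
      unfold modulus at hpos
      rw [ha, hb] at hpos
      simp at hpos
    unfold Dof
    nlinarith [hL0, hvv, hK1]
  · unfold Dof
    nlinarith [hL1, hn', abs_nonneg h, hK1]

/-- **EVERY COARSE CELL IS HIT** (COARSE STEPS for the kit siting): with unit steps, `1 ≤ K`, `8K + 2 ≤ M` and the long-scale facts, for every vertex `w₀` and
every `z : Site 2` there is a vertex `g` with `coarse … g = z`, within ℓ¹-graph-distance `‖(φ t + rep z) − φ w₀‖₁` of `w₀` (`rep` = hp-8's canonical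
representative). [cite: KozmaNitzan2024, §4 Lemma 10 Step IV (pp. 20–21)] -/
theorem exists_coarse_eq [DecidableEq V] [G.LocallyFinite] {φ : V → Site 2} (hstep : Steps G φ) (t w₀ : V) {K : ℕ} {M : ℤ} {n ℓ : ℕ} {h vα : ℤ}
    (hK : 1 ≤ K) (hM : 8 * (K : ℤ) + 2 ≤ M) (hn : M + 1 ≤ n) (hℓ : M + 1 ≤ ℓ) (hlay₁ : (M + 1) * ((n : ℤ) + |h|) ≤ (n : ℤ) * ((ℓ : ℤ) + 1))
    (hv : |vα| ≤ (n : ℤ)) (z : Site 2) :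
    ∃ g, g ∈ graphBall G w₀
        ((φ t 0 + rep 800 n h vα (vβOf n h ℓ vα) (20 * K) z 0 - φ w₀ 0).natAbs +
          (φ t 1 + rep 800 n h vα (vβOf n h ℓ vα) (20 * K) z 1 - φ w₀ 1).natAbs) ∧
      coarse φ t K n h ℓ vα g = z := by
  have hn1 := (one_le_of_floor (by positivity : (0 : ℤ) ≤ 8 * K) hM hn hℓ)
  obtain ⟨hL0, hL1⟩ := rep_adm hK hM hn hℓ hlay₁ hv
  have hD : 0 < Dof n h ℓ vα := Dof_pos hn1.1 hn1.2 h vα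
  have hK1 : (1 : ℤ) ≤ K := by exact_mod_cast hK
  have hc : (0 : ℤ) < 20 * K := by linarith
  set y : Site 2 := fun i => φ t i + rep 800 n h vα (vβOf n h ℓ vα) (20 * K) z i with hy
  obtain ⟨g, hg, hφg⟩ := exists_mem_graphBall_φ_eq hstep w₀ y
  refine ⟨g, by simpa [hy] using hg, ?_⟩
  have hrel : relφ φ t g = rep 800 n h vα (vβOf n h ℓ vα) (20 * K) z := by
    funext i; simp [relφ, hφg, hy]
  have key := coarse_rep (A := 800) (n := n) (h := h) (vα := vα) (vβ := vβOf n h ℓ vα) hc hD hL0 hL1 z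
  funext i
  rw [coarse_eq]
  unfold coarseSkel
  rw [hrel]
  fin_cases i
  · simpa [Dof] using key.1
  · simpa [Dof] using key.2

end NegPrm

end Skelφ

end Summit.CriticalPhenomena.PercolationContinuityZ3.Theorems.Transplant
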